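import Summits.Ventures.CertifiedManyBodySolver.Downfold.EmeryFermiFillingCount
import HarnessLib

/-!
# The filling ↦ Fermi-energy map, IV: ROW-THRESHOLD certificates (O(K) kernel tests instead of O(K²))

Venture CertifiedManyBodySolver, cell `pub/hubbard-downfold` (stage S1), seat hubbard-downfold-mod-4 (technique B); namespace
`Summit.Ventures.CertifiedManyBodySolver.Downfold.Emery`. Everything PROVED. WHAT THIS IS NOT: a statement about any material; no
number lives here. PURPOSE: precision. `EmeryFermiFillingCount` decides every one of the K² grid cells and encloses every grid cosine
with the engine (`K = 24`: ±0.08 in `abFilling`); here the counting is made linear in `K` so that `K` in the hundreds is affordable: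

* §1 MONOTONE TABLES and ROW THRESHOLDS: on a row `i` the inner test `innerTest (i, j)` is antitone in `j` and the outer value
  `outerVal (i, j)` is antitone in `j` whenever the tables `xh`, `xl` are monotone (`MonoTable`), so ONE test per row at a supplied
  threshold `jin i` / `jout i` certifies the whole row: `rowSum jin / K² ≤ abFilling(ε)` (`rowSum_inner_le_abFilling`) and
  `abFilling(ε) ≤ rowSum jout / K²` (`abFilling_le_rowSum_outer`) — by INCLUSION into / of the flagged finsets of
  `EmeryFermiFillingCount` (no new measure theory), kernel cost O(K);
* the grid table for larger `K` is certified exactly as in `EmeryFermiFillingCount` (`gridEnclCheck`, one engine cosine per node;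
  K = 384 costs ≈ 17 s of kernel time once — `EmeryFermiFillingGrid384`).

Consumers: finer filling statements (van-Hove / Lifshitz dopings, tighter ε_F brackets). Sources: [HybertsenSchluterChristensen1989,
Eq. (1)]; interval arithmetic [folklore] (Moore 1966, Ch. 2–4).
-/

noncomputable section

namespace Summit.Ventures.CertifiedManyBodySolver.Downfold.Emery

open Real Set

/-! ## §1 Monotone tables and row thresholds -/

/-- Boolean check that a rational table is monotone on `0 … K`: `x i ≤ x (i+1)` for `i < K`. [folklore] -/
def monoTableCheck (K : ℕ) (x : ℕ → ℚ) : Bool :=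
  (List.range K).all fun i => decide (x i ≤ x (i + 1))

/-- Soundness: adjacent monotonicity ⇒ monotonicity for all `a ≤ b ≤ K`. [folklore] -/
theorem mono_of_monoTableCheck {K : ℕ} {x : ℕ → ℚ} (h : monoTableCheck K x = true) {a b : ℕ} (hab : a ≤ b) (hb : b ≤ K) :
    x a ≤ x b := by
  simp only [monoTableCheck, List.all_eq_true, List.mem_range, decide_eq_true_eq] at h
  induction b, hab using Nat.le_induction with
  | base => exact le_rfl
  | succ n han ih => exact (ih (Nat.le_of_succ_le hb)).trans (h n (Nat.lt_of_succ_le hb))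

/-- `innerVal` is antitone in the column index on a monotone table (`D, N ≥ 0`, `xh ≥ 0`). [folklore] -/
theorem innerVal_anti {K : ℕ} {xh : ℕ → ℚ} (hm : monoTableCheck K xh = true) (h0 : ∀ i, i ≤ K → 0 ≤ xh i)
    {A D N : ℚ} (hD : 0 ≤ D) (hN : 0 ≤ N) {i j j' : ℕ} (hjj : j ≤ j') (hj' : j' + 1 ≤ K) (hi : i + 1 ≤ K) :
    innerVal xh A D N (i, j') ≤ innerVal xh A D N (i, j) := by
  unfold innerVal
  have hy : xh (j + 1) ≤ xh (j' + 1) := mono_of_monoTableCheck hm (by omega) hj'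
  have hX : 0 ≤ xh (i + 1) := h0 _ hi
  have hY : 0 ≤ xh (j + 1) := h0 _ (by omega)
  nlinarith [mul_le_mul_of_nonneg_left hy hX, mul_nonneg hD (sub_nonneg.2 hy), mul_nonneg hN (mul_nonneg hX (sub_nonneg.2 hy))]

/-- `taylorVal` is antitone in the column index on a monotone table (`aSq, bSq ≥ 0`, `xh ≥ 0`). [folklore] -/
theorem taylorVal_anti {K : ℕ} {xh : ℕ → ℚ} (hm : monoTableCheck K xh = true) (h0 : ∀ i, i ≤ K → 0 ≤ xh i)
    {ε Δlo aSq bSq : ℚ} (ha : 0 ≤ aSq) (hb : 0 ≤ bSq) {i j j' : ℕ} (hjj : j ≤ j') (hj' : j' + 1 ≤ K) (hi : i + 1 ≤ K) :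
    taylorVal xh ε Δlo aSq bSq (i, j') ≤ taylorVal xh ε Δlo aSq bSq (i, j) := by
  unfold taylorVal
  have hy : xh (j + 1) ≤ xh (j' + 1) := mono_of_monoTableCheck hm (by omega) hj'
  have hX : 0 ≤ xh (i + 1) := h0 _ hi
  nlinarith [mul_le_mul_of_nonneg_left hy hX, mul_nonneg hb (mul_nonneg hX (sub_nonneg.2 hy)), mul_nonneg ha (sub_nonneg.2 hy)]

/-- `outerVal` is antitone in the column index on a monotone table (`D, N ≥ 0`, `xl ≥ 0`). [folklore] -/
theorem outerVal_anti {K : ℕ} {xl : ℕ → ℚ} (hm : monoTableCheck K xl = true) (h0 : ∀ i, i ≤ K → 0 ≤ xl i)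
    {A D N : ℚ} (hD : 0 ≤ D) (hN : 0 ≤ N) {i j j' : ℕ} (hjj : j ≤ j') (hj' : j' ≤ K) (hi : i ≤ K) :
    outerVal xl A D N (i, j') ≤ outerVal xl A D N (i, j) := by
  unfold outerVal
  have hy : xl j ≤ xl j' := mono_of_monoTableCheck hm hjj hj'
  have hX : 0 ≤ xl i := h0 _ hi
  nlinarith [mul_le_mul_of_nonneg_left hy hX, mul_nonneg hD (sub_nonneg.2 hy), mul_nonneg hN (mul_nonneg hX (sub_nonneg.2 hy))]

/-- Sum of a threshold function over the rows `0 … K−1`. [folklore] -/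
def rowSum (K : ℕ) (j : ℕ → ℕ) : ℕ := ∑ i ∈ Finset.range K, j i

/-- Non-negativity check of a table on `0 … K`. [folklore] -/
def nonnegTableCheck (K : ℕ) (x : ℕ → ℚ) : Bool :=
  (List.range (K + 1)).all fun i => decide (0 ≤ x i)

/-- [folklore] -/
theorem nonneg_of_nonnegTableCheck {K : ℕ} {x : ℕ → ℚ} (h : nonnegTableCheck K x = true) :
    ∀ i, i ≤ K → 0 ≤ x i := by
  simp only [nonnegTableCheck, List.all_eq_true, List.mem_range, decide_eq_true_eq] at h
  exact fun i hi => h i (Nat.lt_succ_of_le hi)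

/-- ROW-THRESHOLD INNER CHECK: monotone non-negative `xh`, `D, N, aSq, bSq ≥ 0`, and for every row `i < K` a threshold
`jin i ≤ K` with the inner test passing at the LAST cell `(i, jin i − 1)` (vacuous if `jin i = 0`). [folklore] -/
def rowInnerCheck (K : ℕ) (xh : ℕ → ℚ) (ε A D N Δlo aSq bSq : ℚ) (jin : ℕ → ℕ) : Bool :=
  monoTableCheck K xh && nonnegTableCheck K xh && decide (0 ≤ D) && decide (0 ≤ N) && decide (0 ≤ aSq) &&
  decide (0 ≤ bSq) &&
  (List.range K).all fun i =>
    decide (jin i ≤ K) && (decide (jin i = 0) || innerTest xh ε A D N Δlo aSq bSq (i, jin i - 1))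

/-- The cells below a row threshold: `{(i, j) : i < K, j < thr i}`. [folklore] -/
def rowCells (K : ℕ) (thr : ℕ → ℕ) : Finset (ℕ × ℕ) :=
  (Finset.range K).biUnion fun i => (Finset.range (thr i)).image fun j => (i, j)

/-- [folklore] -/
theorem mem_rowCells {K : ℕ} {thr : ℕ → ℕ} {ij : ℕ × ℕ} : ij ∈ rowCells K thr ↔ ij.1 < K ∧ ij.2 < thr ij.1 := by
  constructor
  · intro h
    simp only [rowCells, Finset.mem_biUnion, Finset.mem_range, Finset.mem_image] at h
    obtain ⟨i, hi, j, hj, rfl⟩ := h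
    exact ⟨hi, hj⟩
  · intro h
    simp only [rowCells, Finset.mem_biUnion, Finset.mem_range, Finset.mem_image]
    exact ⟨ij.1, h.1, ij.2, h.2, rfl⟩

/-- `card(rowCells) = rowSum`. [folklore] -/
theorem card_rowCells (K : ℕ) (thr : ℕ → ℕ) : (rowCells K thr).card = rowSum K thr := by
  unfold rowCells rowSum
  rw [Finset.card_biUnion]
  · refine Finset.sum_congr rfl fun i _ => ?_
    rw [Finset.card_image_of_injective _ (fun a b hab => by simpa using hab), Finset.card_range]
  · intro i _ i' _ hne
    rw [Function.onFun, Finset.disjoint_left]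
    intro ij h1 h2
    simp only [Finset.mem_image, Finset.mem_range] at h1 h2
    obtain ⟨j, _, rfl⟩ := h1
    obtain ⟨j', _, hjj⟩ := h2
    exact hne (Prod.mk.inj hjj).1.symm

/-- The row-threshold cells are inner-flagged. [folklore] -/
theorem rowCells_subset_innerFlagged {K : ℕ} {xh : ℕ → ℚ} {ε A D N Δlo aSq bSq : ℚ} {jin : ℕ → ℕ}
    (h : rowInnerCheck K xh ε A D N Δlo aSq bSq jin = true) :
    rowCells K jin ⊆ innerFlagged K xh ε A D N Δlo aSq bSq := by
  simp only [rowInnerCheck, Bool.and_eq_true, decide_eq_true_eq, List.all_eq_true, List.mem_range,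
    Bool.or_eq_true] at h
  obtain ⟨⟨⟨⟨⟨⟨hm, h0⟩, hD⟩, hN⟩, ha⟩, hb⟩, hall⟩ := h
  have h0' := nonneg_of_nonnegTableCheck h0
  intro ij hij
  rw [mem_rowCells] at hij
  obtain ⟨hi, hj⟩ := hij
  obtain ⟨hjK, htest⟩ := hall ij.1 hi
  rcases htest with hzero | htest
  · omega
  rw [innerFlagged, Finset.mem_filter, Finset.mem_product, Finset.mem_range, Finset.mem_range]
  refine ⟨⟨hi, by omega⟩, ?_⟩
  simp only [innerTest, Bool.and_eq_true, decide_eq_true_eq] at htest ⊢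
  have hjj : ij.2 ≤ jin ij.1 - 1 := by omega
  have hj' : jin ij.1 - 1 + 1 ≤ K := by omega
  have hi' : ij.1 + 1 ≤ K := by omega
  have e1 := innerVal_anti hm h0' hD hN (A := A) (i := ij.1) hjj hj' hi'
  have e2 := taylorVal_anti hm h0' ha hb (ε := ε) (Δlo := Δlo) (i := ij.1) hjj hj' hi'
  exact ⟨lt_of_lt_of_le htest.1 e1, htest.2.trans e2⟩

/-- **ROW-THRESHOLD INNER THEOREM**: `rowSum jin / K² ≤ abFilling(ε)` under the hypotheses of
`card_innerFlagged_le_abFilling` and a passing `rowInnerCheck`. [folklore] -/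
theorem rowSum_inner_le_abFilling {K : ℕ} (hK : 0 < K) {xl xh : ℕ → ℚ} (hG : GridEncl K xl xh)
    {Δ tpd tpp c : ℝ} {ε A D N Δlo aSqHi bSqHi : ℚ} {jin : ℕ → ℕ}
    (hrow : rowInnerCheck K xh ε A D N Δlo aSqHi bSqHi jin = true)
    (hA : (A : ℝ) ≤ cA Δ ε) (hD : fsD Δ tpd c ε ≤ D) (hN : fsN tpd tpp c ε ≤ N)
    (hD0 : 0 ≤ D) (hN0 : 0 ≤ N) (hΔ : (Δlo : ℝ) ≤ Δ) (hΔ0 : 0 ≤ Δlo) (hc : 0 ≤ c)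
    (ha : tpd ^ 2 ≤ (aSqHi : ℝ)) (hb : tpp ^ 2 ≤ (bSqHi : ℝ)) (hε : 0 ≤ ε) :
    ((rowSum K jin : ℕ) : ℝ) / (K : ℝ) ^ 2 ≤ abFilling Δ tpd tpp c ε := by
  have hcard := Finset.card_le_card (rowCells_subset_innerFlagged hrow)
  rw [card_rowCells] at hcard
  have hcard' : ((rowSum K jin : ℕ) : ℝ) ≤ ((innerFlagged K xh ε A D N Δlo aSqHi bSqHi).card : ℝ) := by
    exact_mod_cast hcard
  exact (div_le_div_of_nonneg_right hcard' (by positivity)).trans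
    (card_innerFlagged_le_abFilling hK hG hA hD hN hD0 hN0 hΔ hΔ0 hc ha hb hε)

/-- ROW-THRESHOLD OUTER CHECK: monotone non-negative `xl`, `D, N ≥ 0`, and for every row `i < K` a threshold `jout i ≤ K` at
which the outer value is already NEGATIVE (vacuous if `jout i = K`). [folklore] -/
def rowOuterCheck (K : ℕ) (xl : ℕ → ℚ) (A D N : ℚ) (jout : ℕ → ℕ) : Bool :=
  monoTableCheck K xl && nonnegTableCheck K xl && decide (0 ≤ D) && decide (0 ≤ N) &&
  (List.range K).all fun i => decide (jout i ≤ K) && (decide (jout i = K) || decide (outerVal xl A D N (i, jout i) < 0))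

/-- The outer-flagged cells lie below the row thresholds. [folklore] -/
theorem outerFlagged_subset_rowCells {K : ℕ} {xl : ℕ → ℚ} {A D N : ℚ} {jout : ℕ → ℕ}
    (h : rowOuterCheck K xl A D N jout = true) : outerFlagged K xl A D N ⊆ rowCells K jout := by
  simp only [rowOuterCheck, Bool.and_eq_true, decide_eq_true_eq, List.all_eq_true, List.mem_range,
    Bool.or_eq_true] at h
  obtain ⟨⟨⟨⟨hm, h0⟩, hD⟩, hN⟩, hall⟩ := h
  have h0' := nonneg_of_nonnegTableCheck h0
  intro ij hij
  rw [outerFlagged, Finset.mem_filter, Finset.mem_product, Finset.mem_range, Finset.mem_range] at hij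
  obtain ⟨⟨hi, hj⟩, hval⟩ := hij
  obtain ⟨hjK, htest⟩ := hall ij.1 hi
  rw [mem_rowCells]
  refine ⟨hi, ?_⟩
  rcases htest with hK' | hneg
  · omega
  by_contra hge
  have hge' : jout ij.1 ≤ ij.2 := not_lt.1 hge
  have e := outerVal_anti hm h0' hD hN (A := A) (i := ij.1) hge' hj.le hi.le
  have hval' : 0 ≤ outerVal xl A D N (ij.1, ij.2) := hval
  linarith

/-- **ROW-THRESHOLD OUTER THEOREM**: `abFilling(ε) ≤ rowSum jout / K²` under the hypotheses of
`abFilling_le_card_outerFlagged` and a passing `rowOuterCheck`. [folklore] -/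
theorem abFilling_le_rowSum_outer {K : ℕ} (hK : 0 < K) {xl xh : ℕ → ℚ} (hG : GridEncl K xl xh)
    {Δ tpd tpp c : ℝ} {ε A D N : ℚ} {jout : ℕ → ℕ} (hrow : rowOuterCheck K xl A D N jout = true)
    (hA : cA Δ ε ≤ A) (hD : (D : ℝ) ≤ fsD Δ tpd c ε) (hN : (N : ℝ) ≤ fsN tpd tpp c ε)
    (hD0 : 0 ≤ D) (hN0 : 0 ≤ N) :
    abFilling Δ tpd tpp c ε ≤ ((rowSum K jout : ℕ) : ℝ) / (K : ℝ) ^ 2 := by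
  have hcard := Finset.card_le_card (outerFlagged_subset_rowCells hrow)
  rw [card_rowCells] at hcard
  have hcard' : ((outerFlagged K xl A D N).card : ℝ) ≤ ((rowSum K jout : ℕ) : ℝ) := by exact_mod_cast hcard
  exact (abFilling_le_card_outerFlagged hK hG hA hD hN hD0 hN0).trans
    (div_le_div_of_nonneg_right hcard' (by positivity))

end Summit.Ventures.CertifiedManyBodySolver.Downfold.Emery
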